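import Mathlib
import Literature.NumberTheory.LFunctions.PrimeNumberTheoremProgressions
import Literature.NumberTheory.Sieve.MaynardSieveLemma52
import HarnessLib

/-!
# The amplifier inequality behind the bilinear Kloosterman-fraction bounds (DFI 1997, Bettin–Chandee 2018)

Topic `NumberTheory/LFunctions` (next to `DeterminantEquationDFI.lean`). The first step of the
amplification method of Duke–Friedlander–Iwaniec, *Bilinear forms with Kloosterman fractions*,
Invent. Math. 128 (1997), as recorded by S. Bettin, V. Chandee, *Trilinear forms with Kloosterman
fractions*, Adv. Math. 328 (2018) (arXiv:1502.00769), §2 "Outline of the proof": for a modulus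
`m`, after Cauchy–Schwarz in `m` one must bound `|∑_{(n,m)=1} c_n|²`; one "introduces an
amplifier" `∑_χ mod m |∑_{ℓ ∈ 𝓛} χ(ℓ)|² |∑_n χ(n) c_n|²`, keeps only the principal character
(`χ₀(ℓ) = [(ℓ, m) = 1]`), and then "squaring out and exploiting the orthogonality relation of
character sums" obtains the sum over `ℓ₁ n₁ ≡ ℓ₂ n₂ (mod m)` (the display defining `𝒟_b` and its
expansion `𝒟_b = 𝒟_b + 𝒪_b`, §2 of the source).  Everything here is PROVED, for an arbitrary
modulus `m ≥ 1`, arbitrary finite sets `S, T ⊂ ℕ` and arbitrary weights `u` (amplifier) and `c`: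

* `DFI_amplifier_principal` — the principal character term:
  `‖∑_{ℓ∈S} u_ℓ χ₀(ℓ)‖² ‖∑_{n∈T} c_n χ₀(n)‖² = ‖∑_{ℓ∈S,(ℓ,m)=1} u_ℓ‖² ‖∑_{n∈T,(n,m)=1} c_n‖²`;
* `DFI_amplifier_inequality` — positivity:
  `‖∑_{(ℓ,m)=1} u_ℓ‖² ‖∑_{(n,m)=1} c_n‖² ≤ ∑_χ ‖∑_ℓ u_ℓ χ(ℓ)‖² ‖∑_n c_n χ(n)‖²`;
* `DFI_amplifier_orthogonality` — orthogonality (Mathlib's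
  `DirichletCharacter.sum_char_inv_mul_char_eq`):
  `∑_χ ‖∑_ℓ u_ℓ χ(ℓ)‖² ‖∑_n c_n χ(n)‖² = φ(m) ∑_{ℓ₁,n₁,ℓ₂,n₂ : (ℓ₂n₂,m)=1, ℓ₁n₁ ≡ ℓ₂n₂ (m)} u_{ℓ₁} c_{n₁} conj(u_{ℓ₂} c_{n₂})`.
* `DFI_amplifier_bound_of_le_card` — with `u = 1_𝓛` and `P ≤ #{ℓ ∈ 𝓛 : (ℓ, m) = 1}`:
  `|∑_{(n,m)=1} c_n|² ≤ φ(m) P⁻² |∑_{ℓ₁n₁ ≡ ℓ₂n₂ (m), (ℓ₂n₂,m)=1} c_{n₁} c̄_{n₂}|`.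
* The amplifier `𝓛 = {primes in (L, 2L]}` of the source: `DFI_card_primes_dvd_mul_log_le`
  (`#{ℓ ∈ 𝓛 : ℓ ∣ m} log L ≤ log m`, so `#{ℓ ∈ 𝓛 : (ℓ, m) = 1} ≥ #𝓛 − log m / log L`, cf. "If
  `L > 2 log(bϑM)`, then `∑_{ℓ ∈ 𝓛, (ℓ, ϑb) = 1} χ₀(ℓ) ≫ L / log L`", §2 of the source) and
  `DFI_card_primes_Ioc_ge` (`#𝓛 ≥ L/(2 log L)` for `L ≥ L₀`, from the prime number theorem
  `ϑ(x) ∼ x` of the tree, `chebyshevTheta_sub_self_isLittleO`).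

Additional tree inputs: `Literature.NumberTheory.LFunctions.chebyshevTheta_sub_self_isLittleO`
(PNT, `ϑ`-form), `Literature.NumberTheory.Sieve.MaynardSieve.theta_sub_theta_eq_sum`,
`….sum_le_card_mul_log` (`ϑ(2L) − ϑ(L) ≤ #{L < p ≤ 2L} log(2L)`).

## References

* S. Bettin, V. Chandee, Adv. Math. 328 (2018) 1234–1262, §2 (the amplifier `𝒟_b`, the bound for
  `𝒞_b`, and the orthogonality expansion). [BettinChandee2018]
* W. Duke, J. Friedlander, H. Iwaniec, Invent. Math. 128 (1997) 23–43. [DukeFriedlanderIwaniec1997]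
-/

noncomputable section

open Finset

namespace Literature.NumberTheory.LFunctions

/-- A sum against the principal character mod `m` is the sum over the terms coprime to `m`:
`∑_{x∈S} f(x) χ₀(x) = ∑_{x∈S, (x,m)=1} f(x)`. [folklore] -/
theorem DFI_sum_mul_one_apply (m : ℕ) [NeZero m] (S : Finset ℕ) (f : ℕ → ℂ) :
    ∑ x ∈ S, f x * (1 : DirichletCharacter ℂ m) (x : ZMod m) = ∑ x ∈ S with x.Coprime m, f x := by
  rw [Finset.sum_filter]
  refine Finset.sum_congr rfl fun x _ => ?_
  by_cases hx : x.Coprime m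
  · rw [if_pos hx, MulChar.one_apply ((ZMod.isUnit_iff_coprime x m).mpr hx), mul_one]
  · rw [if_neg hx, MulChar.map_nonunit _ (fun h => hx ((ZMod.isUnit_iff_coprime x m).mp h)),
      mul_zero]

/-- **The principal character term of the amplifier.** [cite: BettinChandee2018, §2] -/
theorem DFI_amplifier_principal (m : ℕ) [NeZero m] (S T : Finset ℕ) (u c : ℕ → ℂ) :
    ‖∑ ℓ ∈ S, u ℓ * (1 : DirichletCharacter ℂ m) (ℓ : ZMod m)‖ ^ 2 *
        ‖∑ n ∈ T, c n * (1 : DirichletCharacter ℂ m) (n : ZMod m)‖ ^ 2 =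
      ‖∑ ℓ ∈ S with ℓ.Coprime m, u ℓ‖ ^ 2 * ‖∑ n ∈ T with n.Coprime m, c n‖ ^ 2 := by
  rw [DFI_sum_mul_one_apply, DFI_sum_mul_one_apply]

/-- **The amplifier inequality** (keep only `χ = χ₀` in a sum of nonnegative terms):
`‖∑_{ℓ∈S,(ℓ,m)=1} u_ℓ‖² ‖∑_{n∈T,(n,m)=1} c_n‖² ≤ ∑_{χ mod m} ‖∑_{ℓ∈S} u_ℓ χ(ℓ)‖² ‖∑_{n∈T} c_n χ(n)‖²`.
[cite: BettinChandee2018, §2] -/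
theorem DFI_amplifier_inequality (m : ℕ) [NeZero m] (S T : Finset ℕ) (u c : ℕ → ℂ) :
    ‖∑ ℓ ∈ S with ℓ.Coprime m, u ℓ‖ ^ 2 * ‖∑ n ∈ T with n.Coprime m, c n‖ ^ 2 ≤
      ∑ χ : DirichletCharacter ℂ m, ‖∑ ℓ ∈ S, u ℓ * χ (ℓ : ZMod m)‖ ^ 2 *
        ‖∑ n ∈ T, c n * χ (n : ZMod m)‖ ^ 2 := by
  rw [← DFI_amplifier_principal]
  exact Finset.single_le_sum
    (f := fun χ : DirichletCharacter ℂ m =>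
      ‖∑ ℓ ∈ S, u ℓ * χ (ℓ : ZMod m)‖ ^ 2 * ‖∑ n ∈ T, c n * χ (n : ZMod m)‖ ^ 2)
    (fun χ _ => by positivity) (Finset.mem_univ 1)

/-- Orthogonality in the form used: for `a, b ∈ ℤ/mℤ`,
`∑_χ χ(b) · conj(χ(a)) = φ(m)` if `a` is a unit and `a = b`, and `= 0` otherwise
(`conj χ(a) = χ⁻¹(a) = χ(a⁻¹)` for a unit, `= 0` for a non-unit). [folklore] -/
theorem DFI_sum_char_mul_conj_char (m : ℕ) [NeZero m] (a b : ZMod m) :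
    ∑ χ : DirichletCharacter ℂ m, χ b * (starRingEnd ℂ) (χ a) =
      if IsUnit a ∧ b = a then (m.totient : ℂ) else 0 := by
  by_cases ha : IsUnit a
  · have hinv : ∀ χ : DirichletCharacter ℂ m, (starRingEnd ℂ) (χ a) = χ a⁻¹ := by
      intro χ
      have h1 : (starRingEnd ℂ) (χ a) = χ⁻¹ a := MulChar.star_apply' χ a
      rw [h1, MulChar.inv_apply]
      congr 1
      obtain ⟨w, rfl⟩ := ha
      rw [Ring.inverse_unit, ZMod.inv_coe_unit]
    calc ∑ χ : DirichletCharacter ℂ m, χ b * (starRingEnd ℂ) (χ a)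
        = ∑ χ : DirichletCharacter ℂ m, χ a⁻¹ * χ b :=
          Finset.sum_congr rfl fun χ _ => by rw [hinv, mul_comm]
      _ = if a = b then (m.totient : ℂ) else 0 := DirichletCharacter.sum_char_inv_mul_char_eq ℂ ha b
      _ = if IsUnit a ∧ b = a then (m.totient : ℂ) else 0 := by
          by_cases hab : b = a
          · rw [if_pos hab.symm, if_pos ⟨ha, hab⟩]
          · rw [if_neg (fun h' => hab h'.symm), if_neg (fun h' => hab h'.2)]
  · rw [if_neg (fun h' => ha h'.1)]
    refine Finset.sum_eq_zero fun χ _ => ?_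
    rw [MulChar.map_nonunit _ ha, map_zero, mul_zero]

/-- **Squaring out the amplifier: orthogonality.**
`∑_{χ mod m} ‖∑_{ℓ∈S} u_ℓ χ(ℓ)‖² ‖∑_{n∈T} c_n χ(n)‖²
  = φ(m) ∑_{ℓ₁∈S} ∑_{n₁∈T} ∑_{ℓ₂∈S} ∑_{n₂∈T} [(ℓ₂n₂, m) = 1, ℓ₁n₁ ≡ ℓ₂n₂ (mod m)] u_{ℓ₁} c_{n₁} conj(u_{ℓ₂} c_{n₂})`
(the diagonal `ℓ₁n₁ = ℓ₂n₂` and off-diagonal terms of the source are the two parts of the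
right-hand side). [cite: BettinChandee2018, §2] -/
theorem DFI_amplifier_orthogonality (m : ℕ) [NeZero m] (S T : Finset ℕ) (u c : ℕ → ℂ) :
    ∑ χ : DirichletCharacter ℂ m, (((‖∑ ℓ ∈ S, u ℓ * χ (ℓ : ZMod m)‖ ^ 2 *
        ‖∑ n ∈ T, c n * χ (n : ZMod m)‖ ^ 2 : ℝ)) : ℂ) =
      (m.totient : ℂ) * ∑ ℓ₁ ∈ S, ∑ n₁ ∈ T, ∑ ℓ₂ ∈ S, ∑ n₂ ∈ T,
        if (ℓ₂ * n₂).Coprime m ∧ ((ℓ₁ * n₁ : ℕ) : ZMod m) = ((ℓ₂ * n₂ : ℕ) : ZMod m) then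
          u ℓ₁ * c n₁ * (starRingEnd ℂ) (u ℓ₂ * c n₂) else 0 := by
  -- each `χ`-term is `|A_χ C_χ|² = (A_χ C_χ) · conj (A_χ C_χ)` with `A_χ C_χ = ∑_{ℓ,n} u c χ(ℓn)`
  have hterm : ∀ χ : DirichletCharacter ℂ m,
      ((‖∑ ℓ ∈ S, u ℓ * χ (ℓ : ZMod m)‖ ^ 2 * ‖∑ n ∈ T, c n * χ (n : ZMod m)‖ ^ 2 : ℝ) : ℂ) =
        ∑ ℓ₁ ∈ S, ∑ n₁ ∈ T, ∑ ℓ₂ ∈ S, ∑ n₂ ∈ T,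
          u ℓ₁ * c n₁ * (starRingEnd ℂ) (u ℓ₂ * c n₂) *
            (χ (((ℓ₁ * n₁ : ℕ) : ZMod m)) * (starRingEnd ℂ) (χ (((ℓ₂ * n₂ : ℕ) : ZMod m)))) := by
    intro χ
    have hP : (∑ ℓ ∈ S, u ℓ * χ (ℓ : ZMod m)) * (∑ n ∈ T, c n * χ (n : ZMod m)) =
        ∑ ℓ ∈ S, ∑ n ∈ T, u ℓ * c n * χ (((ℓ * n : ℕ) : ZMod m)) := by
      rw [Finset.sum_mul_sum]
      refine Finset.sum_congr rfl fun ℓ _ => Finset.sum_congr rfl fun n _ => ?_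
      rw [Nat.cast_mul, map_mul]
      ring
    have hnorm : ((‖∑ ℓ ∈ S, u ℓ * χ (ℓ : ZMod m)‖ ^ 2 *
          ‖∑ n ∈ T, c n * χ (n : ZMod m)‖ ^ 2 : ℝ) : ℂ) =
        ((∑ ℓ ∈ S, u ℓ * χ (ℓ : ZMod m)) * (∑ n ∈ T, c n * χ (n : ZMod m))) *
          (starRingEnd ℂ) ((∑ ℓ ∈ S, u ℓ * χ (ℓ : ZMod m)) *
            (∑ n ∈ T, c n * χ (n : ZMod m))) := by
      rw [← mul_pow, ← norm_mul]
      push_cast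
      rw [← Complex.mul_conj']
    rw [hnorm, hP, map_sum, Finset.sum_mul_sum]
    refine Finset.sum_congr rfl fun ℓ₁ _ => ?_
    simp_rw [map_sum (starRingEnd ℂ), Finset.sum_mul_sum]
    rw [Finset.sum_comm]
    refine Finset.sum_congr rfl fun n₁ _ => Finset.sum_congr rfl fun ℓ₂ _ =>
      Finset.sum_congr rfl fun n₂ _ => ?_
    rw [map_mul (starRingEnd ℂ) (u ℓ₂ * c n₂)]
    ring
  simp_rw [hterm]
  -- exchange the sum over `χ` with the four finite sums and apply orthogonality
  rw [Finset.sum_comm]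
  rw [Finset.mul_sum]
  refine Finset.sum_congr rfl fun ℓ₁ _ => ?_
  rw [Finset.sum_comm, Finset.mul_sum]
  refine Finset.sum_congr rfl fun n₁ _ => ?_
  rw [Finset.sum_comm, Finset.mul_sum]
  refine Finset.sum_congr rfl fun ℓ₂ _ => ?_
  rw [Finset.sum_comm, Finset.mul_sum]
  refine Finset.sum_congr rfl fun n₂ _ => ?_
  rw [← Finset.mul_sum, DFI_sum_char_mul_conj_char]
  by_cases h : (ℓ₂ * n₂).Coprime m
  · have hu : IsUnit (((ℓ₂ * n₂ : ℕ)) : ZMod m) := (ZMod.isUnit_iff_coprime _ m).mpr h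
    by_cases he : ((ℓ₁ * n₁ : ℕ) : ZMod m) = ((ℓ₂ * n₂ : ℕ) : ZMod m)
    · rw [if_pos ⟨hu, he⟩, if_pos ⟨h, he⟩]; ring
    · rw [if_neg (fun h' => he h'.2), if_neg (fun h' => he h'.2)]; ring
  · have hu : ¬ IsUnit (((ℓ₂ * n₂ : ℕ)) : ZMod m) :=
      fun h' => h ((ZMod.isUnit_iff_coprime _ m).mp h')
    rw [if_neg (fun h' => hu h'.1), if_neg (fun h' => h h'.1)]; ring


/-- **The amplifier bound** (the two previous results combined):
`‖∑_{ℓ∈S,(ℓ,m)=1} u_ℓ‖² ‖∑_{n∈T,(n,m)=1} c_n‖²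
  ≤ φ(m) ‖∑_{ℓ₁,n₁,ℓ₂,n₂ : (ℓ₂n₂,m)=1, ℓ₁n₁ ≡ ℓ₂n₂ (mod m)} u_{ℓ₁} c_{n₁} conj(u_{ℓ₂} c_{n₂})‖`;
with `u = 1_𝓛` this is `|∑_{(n,m)=1} c_n|² ≤ φ(m) P_m^{-2} |∑_{ℓ₁n₁≡ℓ₂n₂ (m)} c_{n₁} c̄_{n₂}|`,
`P_m = #{ℓ ∈ 𝓛 : (ℓ, m) = 1}`, the inequality behind "`𝒞_b ≪ M L^{-2+ε} 𝒟_b`" of the source.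
[cite: BettinChandee2018, §2] -/
theorem DFI_amplifier_bound (m : ℕ) [NeZero m] (S T : Finset ℕ) (u c : ℕ → ℂ) :
    ‖∑ ℓ ∈ S with ℓ.Coprime m, u ℓ‖ ^ 2 * ‖∑ n ∈ T with n.Coprime m, c n‖ ^ 2 ≤
      (m.totient : ℝ) * ‖∑ ℓ₁ ∈ S, ∑ n₁ ∈ T, ∑ ℓ₂ ∈ S, ∑ n₂ ∈ T,
        if (ℓ₂ * n₂).Coprime m ∧ ((ℓ₁ * n₁ : ℕ) : ZMod m) = ((ℓ₂ * n₂ : ℕ) : ZMod m) then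
          u ℓ₁ * c n₁ * (starRingEnd ℂ) (u ℓ₂ * c n₂) else 0‖ := by
  refine (DFI_amplifier_inequality m S T u c).trans (le_of_eq ?_)
  have h := DFI_amplifier_orthogonality m S T u c
  have hX : 0 ≤ ∑ χ : DirichletCharacter ℂ m, ‖∑ ℓ ∈ S, u ℓ * χ (ℓ : ZMod m)‖ ^ 2 *
      ‖∑ n ∈ T, c n * χ (n : ZMod m)‖ ^ 2 := Finset.sum_nonneg fun χ _ => by positivity
  calc (∑ χ : DirichletCharacter ℂ m, ‖∑ ℓ ∈ S, u ℓ * χ (ℓ : ZMod m)‖ ^ 2 *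
          ‖∑ n ∈ T, c n * χ (n : ZMod m)‖ ^ 2 : ℝ)
      = ‖((∑ χ : DirichletCharacter ℂ m, ‖∑ ℓ ∈ S, u ℓ * χ (ℓ : ZMod m)‖ ^ 2 *
          ‖∑ n ∈ T, c n * χ (n : ZMod m)‖ ^ 2 : ℝ) : ℂ)‖ := by
        rw [Complex.norm_real, Real.norm_of_nonneg hX]
    _ = _ := by
        rw [Complex.ofReal_sum, h, norm_mul, Complex.norm_natCast]


/-! ### The amplifier over the primes of a dyadic interval -/

/-- **The amplifier bound with a lower bound for the principal term**: if `0 < P ≤ #{ℓ ∈ 𝓛 : (ℓ,m)=1}`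
then `‖∑_{n∈T,(n,m)=1} c_n‖² ≤ φ(m) P⁻² ‖∑_{ℓ₁,n₁,ℓ₂,n₂ : (ℓ₂n₂,m)=1, ℓ₁n₁≡ℓ₂n₂ (m)} c_{n₁} conj(c_{n₂})‖`
(`DFI_amplifier_bound` with `u = 1`). [cite: BettinChandee2018, §2] -/
theorem DFI_amplifier_bound_of_le_card (m : ℕ) [NeZero m] (S T : Finset ℕ) (c : ℕ → ℂ)
    {P : ℝ} (hP : 0 < P) (hPS : P ≤ ((S.filter (fun ℓ => ℓ.Coprime m)).card : ℝ)) :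
    ‖∑ n ∈ T with n.Coprime m, c n‖ ^ 2 ≤
      (m.totient : ℝ) / P ^ 2 * ‖∑ ℓ₁ ∈ S, ∑ n₁ ∈ T, ∑ ℓ₂ ∈ S, ∑ n₂ ∈ T,
        if (ℓ₂ * n₂).Coprime m ∧ ((ℓ₁ * n₁ : ℕ) : ZMod m) = ((ℓ₂ * n₂ : ℕ) : ZMod m) then
          c n₁ * (starRingEnd ℂ) (c n₂) else 0‖ := by
  have h := DFI_amplifier_bound m S T (fun _ => (1 : ℂ)) c
  simp only [one_mul, Finset.sum_const, nsmul_eq_mul, mul_one] at h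
  rw [Complex.norm_natCast] at h
  -- `h : (#coprime)^2 * X ≤ φ * Y`; divide by `(#coprime)^2 ≥ P^2`
  set X := ‖∑ n ∈ T with n.Coprime m, c n‖ ^ 2 with hX
  have hX0 : 0 ≤ X := by positivity
  have hcard : P ^ 2 ≤ ((S.filter (fun ℓ => ℓ.Coprime m)).card : ℝ) ^ 2 := by gcongr
  have hP2 : 0 < P ^ 2 := by positivity
  rw [div_mul_eq_mul_div, le_div_iff₀ hP2]
  calc X * P ^ 2 ≤ X * ((S.filter (fun ℓ => ℓ.Coprime m)).card : ℝ) ^ 2 := by gcongr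
    _ = ((S.filter (fun ℓ => ℓ.Coprime m)).card : ℝ) ^ 2 * X := mul_comm _ _
    _ ≤ _ := h

/-- **Few primes `> L` divide `m`**: if every element of `𝓛` is a prime `> L ≥ 1` then for `m ≥ 1`,
`#{ℓ ∈ 𝓛 : ℓ ∣ m} · log L ≤ log m` (their product divides `m` and exceeds `L^{#}`); hence the
number of `ℓ ∈ 𝓛` coprime to `m` is at least `#𝓛 − log m / log L`. [folklore] -/
theorem DFI_card_primes_dvd_mul_log_le {𝓛 : Finset ℕ} {L : ℝ} (hL : 1 ≤ L)
    (h𝓛 : ∀ ℓ ∈ 𝓛, ℓ.Prime ∧ L < ℓ) {m : ℕ} (hm : 0 < m) :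
    ((𝓛.filter (fun ℓ => ℓ ∣ m)).card : ℝ) * Real.log L ≤ Real.log m := by
  have hprod_dvd : ∏ ℓ ∈ 𝓛.filter (fun ℓ => ℓ ∣ m), ℓ ∣ m :=
    Finset.prod_primes_dvd m (fun ℓ hℓ => (h𝓛 ℓ (Finset.mem_filter.mp hℓ).1).1.prime)
      (fun ℓ hℓ => (Finset.mem_filter.mp hℓ).2)
  have hprod_le : ((∏ ℓ ∈ 𝓛.filter (fun ℓ => ℓ ∣ m), ℓ : ℕ) : ℝ) ≤ m := by
    exact_mod_cast Nat.le_of_dvd hm hprod_dvd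
  have hpow_le : L ^ (𝓛.filter (fun ℓ => ℓ ∣ m)).card ≤
      ((∏ ℓ ∈ 𝓛.filter (fun ℓ => ℓ ∣ m), ℓ : ℕ) : ℝ) := by
    rw [Nat.cast_prod, ← Finset.prod_const]
    refine Finset.prod_le_prod (fun _ _ => by linarith) fun ℓ hℓ => ?_
    exact (h𝓛 ℓ (Finset.mem_filter.mp hℓ).1).2.le
  have hL0 : 0 < L := by linarith
  calc ((𝓛.filter (fun ℓ => ℓ ∣ m)).card : ℝ) * Real.log L
      = Real.log (L ^ (𝓛.filter (fun ℓ => ℓ ∣ m)).card) := by rw [Real.log_pow]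
    _ ≤ Real.log m := Real.log_le_log (by positivity) (hpow_le.trans hprod_le)

/-- For a prime `ℓ`, `(ℓ, m) = 1 ↔ ℓ ∤ m`; so `#{ℓ ∈ 𝓛 : (ℓ,m)=1} = #𝓛 − #{ℓ ∈ 𝓛 : ℓ ∣ m}` for a set
`𝓛` of primes. [folklore] -/
theorem DFI_card_filter_coprime_eq {𝓛 : Finset ℕ} (h𝓛 : ∀ ℓ ∈ 𝓛, ℓ.Prime) (m : ℕ) :
    (𝓛.filter (fun ℓ => ℓ.Coprime m)).card = 𝓛.card - (𝓛.filter (fun ℓ => ℓ ∣ m)).card := by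
  have h1 : 𝓛.filter (fun ℓ => ℓ.Coprime m) = 𝓛.filter (fun ℓ => ¬ ℓ ∣ m) :=
    Finset.filter_congr fun ℓ hℓ => (h𝓛 ℓ hℓ).coprime_iff_not_dvd
  rw [h1, Finset.filter_not, Finset.card_sdiff_of_subset (Finset.filter_subset _ _)]

open Filter Asymptotics in
/-- **Primes in a dyadic interval** (from the prime number theorem `ϑ(x) ∼ x` of the tree): there
is `L₀` such that `#{L < p ≤ 2L : p prime} ≥ L / (2 log L)` for all integers `L ≥ L₀`
(`ϑ(2L) − ϑ(L) ≥ (13/16) L` eventually, and `ϑ(2L) − ϑ(L) ≤ # · log(2L) ≤ # · (3/2) log L` for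
`L ≥ 4`). [folklore] -/
theorem DFI_card_primes_Ioc_ge : ∃ L₀ : ℕ, ∀ L : ℕ, L₀ ≤ L →
    (L : ℝ) / (2 * Real.log L) ≤ (((Finset.Ioc L (2 * L)).filter Nat.Prime).card : ℝ) := by
  have hPNT := Literature.NumberTheory.LFunctions.chebyshevTheta_sub_self_isLittleO
  have hev := hPNT.def (show (0 : ℝ) < 1 / 16 by norm_num)
  rw [Filter.eventually_atTop] at hev
  obtain ⟨N₀, hN₀⟩ := hev
  refine ⟨max N₀ 4, fun L hL => ?_⟩
  have hLN : N₀ ≤ L := le_of_max_le_left hL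
  have hL4 : 4 ≤ L := le_of_max_le_right hL
  have hL0 : (0 : ℝ) < L := by exact_mod_cast (show 0 < L by omega)
  have hL4' : (4 : ℝ) ≤ L := by exact_mod_cast hL4
  -- `|ϑ(L) − L| ≤ L/16`, `|ϑ(2L) − 2L| ≤ 2L/16`
  have h1 := hN₀ L hLN
  have h2 := hN₀ (2 * L) (by omega)
  rw [Real.norm_eq_abs, Real.norm_eq_abs] at h1 h2
  have h1' := (abs_le.mp (h1.trans (le_of_eq (by rw [abs_of_nonneg hL0.le])))).2
  have h2' := (abs_le.mp (h2.trans (le_of_eq (by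
    rw [abs_of_nonneg (by positivity : (0 : ℝ) ≤ ((2 * L : ℕ) : ℝ))])))).1
  push_cast at h1' h2'
  -- `ϑ(2L) − ϑ(L) ≤ # log(2L)`
  have hsum : Chebyshev.theta ((2 * L : ℕ) : ℝ) - Chebyshev.theta (L : ℝ) ≤
      (((Finset.Ioc L (2 * L)).filter Nat.Prime).card : ℝ) * Real.log ((2 * L : ℕ) : ℝ) := by
    rw [Literature.NumberTheory.Sieve.MaynardSieve.theta_sub_theta_eq_sum (by omega : L ≤ 2 * L)]
    exact Literature.NumberTheory.Sieve.MaynardSieve.sum_le_card_mul_log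
  push_cast at hsum
  -- `log(2L) ≤ (3/2) log L` for `L ≥ 4`
  have hlogL : 0 < Real.log L := Real.log_pos (by linarith)
  have hlog2L : Real.log (2 * (L : ℝ)) ≤ 3 / 2 * Real.log L := by
    have h4 : (2 * (L : ℝ)) ^ (2 : ℕ) ≤ (L : ℝ) ^ (3 : ℕ) := by nlinarith
    have h5 : Real.log ((2 * (L : ℝ)) ^ (2 : ℕ)) ≤ Real.log ((L : ℝ) ^ (3 : ℕ)) :=
      Real.log_le_log (by positivity) h4
    rw [Real.log_pow, Real.log_pow] at h5
    push_cast at h5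
    linarith
  -- assemble: `(13/16) L ≤ # · (3/2) log L`
  set C : ℝ := (((Finset.Ioc L (2 * L)).filter Nat.Prime).card : ℝ) with hC
  have hC0 : 0 ≤ C := by positivity
  have hmain : 13 / 16 * (L : ℝ) ≤ C * (3 / 2 * Real.log L) := by
    calc 13 / 16 * (L : ℝ) ≤ Chebyshev.theta (2 * (L : ℝ)) - Chebyshev.theta (L : ℝ) := by linarith
      _ ≤ C * Real.log (2 * (L : ℝ)) := hsum
      _ ≤ C * (3 / 2 * Real.log L) := by gcongr
  rw [div_le_iff₀ (by positivity)]
  nlinarith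

end Literature.NumberTheory.LFunctions

end
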